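import Mathlib
import Literature.RingTheory.TwoVariableSeries.Basic
import Summits.ResolutionOfSingularities.ResolutionOfSingularities.Theorems.WeightedInvariantLocalWeightedDropMonicDescentLabels

/-!
# `WeightedInvariant.LocalWeightedDrop`, sub-stub N4″: the label under the point blow-up, origin of the `u₁`-chart (piece T-3a of the N4″ plan)

Crux item stmt-ResolutionOfSingularities-8899 `LocalWeightedDrop` (route `ResolutionOfSingularities/WeightedInvariant`), door
`WeightedConstruction` stmt-ResolutionOfSingularities-0571.  [OURS · L1 W4.3, chain w43, lead prover; piece T-3a of `N4PRIME-PLAN.md`.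
MODEL: Cossart–Jannsen–Saito LNM 2270 Lemma 12.1 / 13.2 (2): "`Δ(f′, y′, (u₁, u₂′))` is the minimal F-subset containing `Ψ(Δ(f,y,u))`,
`Ψ(a₁, a₂) = (a₁ + a₂ − 1, a₂)`", here EXACTLY (no hull needed) on the scaled Newton set of a label `(A₀, A₁) ∈ k[[u₁,u₂]]²`, together
with the persistence of well-preparedness (CJS 12.1 (4)).]

For the transport `(A₀, A₁) ↦ (blowOne 2 A₀, blowOne 1 A₁)` (`A(u₁, u₁u₂)/u₁^c`) of `…MonicDescentLabels`:
* `coeff_blowOne_psi` / `exists_of_coeff_blowOne_ne_zero` — the transport is the BIJECTION `e ↦ Ψ_c e = (e₀ + e₁ − c, e₁)` on exponents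
  with `e₀ + e₁ ≥ c`;
* `newtonSet_blowOne` — if every point of the scaled Newton set has `P₀ + P₁ ≥ 2` (true for positions), the new scaled Newton set is
  EXACTLY the image under `psi 2 P = (P₀ + P₁ − 2, P₁)`;
* `isOdd_blowOne_iff` — oddness is transported pointwise; `isVertex_of_isVertex_blowOne` — a vertex of the image (weight `(w₀, w₁)`) comes
  from a vertex of the source (weight `(w₀, w₀ + w₁)`); hence `wellPrepared_blowOne` — WELL-PREPAREDNESS PERSISTS.
The numerical laws (`2α′ = 2δ − 2`, `2β′ = 2γ⁻ ≤ 2β`, `2ε′ = 2ε`, `2ζ′ = 2ζ + 2ε − 2`) are read off `newtonSet_blowOne` in piece T-3a′.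
-/

set_option linter.dupNamespace false -- mandated namespace of this single-conjunct summit

noncomputable section

namespace Summit.ResolutionOfSingularities.ResolutionOfSingularities.Theorems

namespace MonicDescent

open MvPowerSeries

variable {k : Type} [Field k]

/-- The exponent map of the `u₁`-chart divided by `u₁^c`: `e ↦ (e₀ + e₁ − c, e₁)`. -/
def psi (c : ℕ) (e : Fin 2 →₀ ℕ) : Fin 2 →₀ ℕ :=
  Finsupp.single 0 (e 0 + e 1 - c) + Finsupp.single 1 (e 1)

/-- Components of `psi`. -/
@[simp] theorem psi_apply_zero (c : ℕ) (e : Fin 2 →₀ ℕ) : psi c e 0 = e 0 + e 1 - c := by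
  simp [psi]

/-- Components of `psi`. -/
@[simp] theorem psi_apply_one (c : ℕ) (e : Fin 2 →₀ ℕ) : psi c e 1 = e 1 := by
  simp [psi]

/-- `psi c` is injective on the exponents with `e₀ + e₁ ≥ c`. -/
theorem psi_injOn (c : ℕ) {e e' : Fin 2 →₀ ℕ} (he : c ≤ e 0 + e 1) (he' : c ≤ e' 0 + e' 1)
    (h : psi c e = psi c e') : e = e' := by
  have h0 := congrArg (fun P => P 0) h
  have h1 := congrArg (fun P => P 1) h
  simp only [psi_apply_zero, psi_apply_one] at h0 h1
  exact Literature.RingTheory.TwoVariableSeries.finsupp_fin2_ext (by omega) h1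

/-- `psi` on a doubled exponent: `Ψ₂(2e) = 2 · Ψ₁(e)` when `e₀ + e₁ ≥ 1`. -/
theorem psi_two_smul (e : Fin 2 →₀ ℕ) (he : 1 ≤ e 0 + e 1) : psi 2 (2 • e) = 2 • psi 1 e := by
  refine Literature.RingTheory.TwoVariableSeries.finsupp_fin2_ext ?_ ?_
  · simp only [psi_apply_zero, Finsupp.smul_apply, smul_eq_mul]
    omega
  · simp only [psi_apply_one, Finsupp.smul_apply, smul_eq_mul]

/-- THE TRANSPORT IS EXACT on exponents with `e₀ + e₁ ≥ c`: the coefficient of `blowOne c A` at `Ψ_c(e)` is the coefficient of `A`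
at `e`. -/
theorem coeff_blowOne_psi (c : ℕ) (A : MvPowerSeries (Fin 2) k) (e : Fin 2 →₀ ℕ) (he : c ≤ e 0 + e 1) :
    coeff (psi c e) (blowOne c A) = coeff e A := by
  rw [coeff_blowOne, if_pos (by simp only [psi_apply_zero, psi_apply_one]; omega)]
  have hidx : Finsupp.single 0 (psi c e 0 + c - psi c e 1) + Finsupp.single 1 (psi c e 1) = e := by
    refine Literature.RingTheory.TwoVariableSeries.finsupp_fin2_ext ?_ ?_
    · simp only [Finsupp.add_apply, Finsupp.single_apply, psi_apply_zero, psi_apply_one]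
      simp
      omega
    · simp only [Finsupp.add_apply, Finsupp.single_apply, psi_apply_one]
      simp
  rw [hidx]

/-- Conversely every exponent of `blowOne c A` is `Ψ_c(e)` for an exponent `e` of `A` with `e₀ + e₁ ≥ c`. -/
theorem exists_of_coeff_blowOne_ne_zero (c : ℕ) (A : MvPowerSeries (Fin 2) k) (d : Fin 2 →₀ ℕ)
    (hd : coeff d (blowOne c A) ≠ 0) :
    ∃ e : Fin 2 →₀ ℕ, c ≤ e 0 + e 1 ∧ d = psi c e ∧ coeff e A ≠ 0 := by
  rw [coeff_blowOne] at hd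
  split_ifs at hd with hle
  · refine ⟨Finsupp.single 0 (d 0 + c - d 1) + Finsupp.single 1 (d 1), ?_, ?_, hd⟩
    · simp only [Finsupp.add_apply, Finsupp.single_apply]
      simp
      omega
    · refine Literature.RingTheory.TwoVariableSeries.finsupp_fin2_ext ?_ ?_
      · simp only [psi_apply_zero, Finsupp.add_apply, Finsupp.single_apply]
        simp
        omega
      · simp only [psi_apply_one, Finsupp.add_apply, Finsupp.single_apply]
        simp
  · exact absurd rfl hd

/-- THE SCALED NEWTON SET UNDER THE `u₁`-CHART POINT BLOW-UP is exactly the image under `Ψ(P) = (P₀ + P₁ − 2, P₁)`, provided every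
point has `P₀ + P₁ ≥ 2` (true for positions: `ord A₀ ≥ 2`, `ord A₁ ≥ 1`).  (CJS Lemma 12.1 / 13.2 (2) for a hypersurface double point,
where no convex hull is needed.) -/
theorem newtonSet_blowOne (A₀ A₁ : MvPowerSeries (Fin 2) k) (hN : ∀ P ∈ newtonSet A₀ A₁, 2 ≤ P 0 + P 1) :
    newtonSet (blowOne 2 A₀) (blowOne 1 A₁) = psi 2 '' newtonSet A₀ A₁ := by
  ext d
  constructor
  · rintro (hd | ⟨e', rfl, he'⟩)
    · obtain ⟨e, hle, rfl, he⟩ := exists_of_coeff_blowOne_ne_zero 2 A₀ d hd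
      exact ⟨e, Or.inl he, rfl⟩
    · obtain ⟨e, hle, rfl, he⟩ := exists_of_coeff_blowOne_ne_zero 1 A₁ e' he'
      refine ⟨2 • e, Or.inr ⟨e, rfl, he⟩, ?_⟩
      exact psi_two_smul e hle
  · rintro ⟨P, hP, rfl⟩
    have h2 := hN P hP
    rcases hP with hP | ⟨e, rfl, he⟩
    · left
      change coeff (psi 2 P) (blowOne 2 A₀) ≠ 0
      rwa [coeff_blowOne_psi 2 A₀ P h2]
    · right
      have h1 : 1 ≤ e 0 + e 1 := by
        simp only [Finsupp.smul_apply, smul_eq_mul] at h2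
        omega
      refine ⟨psi 1 e, psi_two_smul e h1, ?_⟩
      rwa [coeff_blowOne_psi 1 A₁ e h1]

/-- ODDNESS IS TRANSPORTED pointwise: for a point `P` of the scaled Newton set (`P₀ + P₁ ≥ 2` for all points), `Ψ(P)` is odd for the
transported label iff `P` is odd. -/
theorem isOdd_blowOne_iff (A₀ A₁ : MvPowerSeries (Fin 2) k) (hN : ∀ P ∈ newtonSet A₀ A₁, 2 ≤ P 0 + P 1)
    {P : Fin 2 →₀ ℕ} (hP : P ∈ newtonSet A₀ A₁) :
    IsOdd (blowOne 2 A₀) (blowOne 1 A₁) (psi 2 P) ↔ IsOdd A₀ A₁ P := by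
  have h2 := hN P hP
  constructor
  · rintro (⟨e', he'eq, he'⟩ | ⟨hc, i, hi⟩)
    · -- an `A₁`-point upstairs comes from an `A₁`-point downstairs
      obtain ⟨e, hle, rfl, he⟩ := exists_of_coeff_blowOne_ne_zero 1 A₁ e' he'
      left
      refine ⟨e, ?_, he⟩
      have hq : psi 2 P = psi 2 (2 • e) := by rw [psi_two_smul e hle]; exact he'eq
      exact psi_injOn 2 h2 (by simp only [Finsupp.smul_apply, smul_eq_mul]; omega) hq
    · right
      rw [coeff_blowOne_psi 2 A₀ P h2] at hc
      refine ⟨hc, ?_⟩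
      have hi2 : i = 0 ∨ i = 1 := by fin_cases i <;> simp
      rcases hi2 with rfl | rfl
      · -- `P₀ + P₁ - 2` odd ⇒ `P₀` odd or `P₁` odd
        simp only [psi_apply_zero] at hi
        by_cases h1 : 2 ∣ P 1
        · refine ⟨0, fun h0 => hi ?_⟩
          obtain ⟨a, ha⟩ := h0
          obtain ⟨b, hb⟩ := h1
          exact ⟨a + b - 1, by omega⟩
        · exact ⟨1, h1⟩
      · simp only [psi_apply_one] at hi
        exact ⟨1, hi⟩
  · rintro (⟨e, rfl, he⟩ | ⟨hc, i, hi⟩)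
    · left
      have h1 : 1 ≤ e 0 + e 1 := by
        simp only [Finsupp.smul_apply, smul_eq_mul] at h2
        omega
      refine ⟨psi 1 e, psi_two_smul e h1, ?_⟩
      rwa [coeff_blowOne_psi 1 A₁ e h1]
    · right
      refine ⟨by rw [coeff_blowOne_psi 2 A₀ P h2]; exact hc, ?_⟩
      have hi2 : i = 0 ∨ i = 1 := by fin_cases i <;> simp
      rcases hi2 with rfl | rfl
      · by_cases h1 : 2 ∣ P 1
        · refine ⟨0, fun h0 => hi ?_⟩
          simp only [psi_apply_zero] at h0
          obtain ⟨a, ha⟩ := h0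
          obtain ⟨b, hb⟩ := h1
          exact ⟨a + 1 - b, by omega⟩
        · exact ⟨1, by simpa using h1⟩
      · exact ⟨1, by simpa using hi⟩

/-- A VERTEX OF THE IMAGE COMES FROM A VERTEX OF THE SOURCE: if `Ψ(P)` is a vertex of `Ψ(N)` (all points of `N` with `P₀ + P₁ ≥ 2`)
for the weight `(w₀, w₁)`, then `P` is a vertex of `N` for the weight `(w₀, w₀ + w₁)`. -/
theorem isVertex_of_isVertex_image {N : Set (Fin 2 →₀ ℕ)} (hN : ∀ P ∈ N, 2 ≤ P 0 + P 1) {P : Fin 2 →₀ ℕ} (hP : P ∈ N)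
    (hv : IsVertex (psi 2 '' N) (psi 2 P)) : IsVertex N P := by
  obtain ⟨-, w, hw, hmin⟩ := hv
  refine ⟨hP, fun i => if i = 0 then w 0 else w 0 + w 1, fun i => ?_, fun Q hQ hne => ?_⟩
  · fin_cases i
    · exact hw 0
    · exact Nat.add_pos_left (hw 0) _
  have hPs := hN P hP
  have hQs := hN Q hQ
  have hneq : psi 2 Q ≠ psi 2 P := fun h => hne (psi_injOn 2 hQs hPs h)
  have hlt := hmin (psi 2 Q) ⟨Q, hQ, rfl⟩ hneq
  have hwt : ∀ R : Fin 2 →₀ ℕ, 2 ≤ R 0 + R 1 →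
      Finsupp.weight w (psi 2 R) + 2 * w 0 = Finsupp.weight (fun i : Fin 2 => if i = 0 then w 0 else w 0 + w 1) R := by
    intro R hR
    rw [Finsupp.weight_apply, Finsupp.weight_apply, Finsupp.sum_fintype _ _ (by simp), Finsupp.sum_fintype _ _ (by simp)]
    simp only [Fin.sum_univ_two, smul_eq_mul, psi_apply_zero, psi_apply_one]
    simp
    have : (R 0 + R 1 - 2) * w 0 + 2 * w 0 = (R 0 + R 1) * w 0 := by
      rw [← Nat.add_mul]; congr 1; omega
    nlinarith [this]
  have := hwt P hPs
  have := hwt Q hQs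
  omega

/-- WELL-PREPAREDNESS PERSISTS under the `u₁`-chart point blow-up (CJS Lemma 12.1 (4) / 13.2 (1) for our labels). -/
theorem wellPrepared_blowOne (A₀ A₁ : MvPowerSeries (Fin 2) k) (hN : ∀ P ∈ newtonSet A₀ A₁, 2 ≤ P 0 + P 1)
    (hWP : WellPrepared A₀ A₁) : WellPrepared (blowOne 2 A₀) (blowOne 1 A₁) := by
  intro Q hQ
  have hQmem : Q ∈ newtonSet (blowOne 2 A₀) (blowOne 1 A₁) := hQ.1
  rw [newtonSet_blowOne A₀ A₁ hN] at hQmem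
  obtain ⟨P, hP, rfl⟩ := hQmem
  rw [isOdd_blowOne_iff A₀ A₁ hN hP]
  refine hWP P (isVertex_of_isVertex_image hN hP ?_)
  rwa [← newtonSet_blowOne A₀ A₁ hN]

end MonicDescent

end Summit.ResolutionOfSingularities.ResolutionOfSingularities.Theorems

end
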